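import Summits.CriticalPhenomena.PercolationContinuityZ3.Theorems.Transplant.FKConnectivityAllQAntipodalPolar
import Summits.CriticalPhenomena.PercolationContinuityZ3.Theorems.Transplant.FKConnectivityAllQAntipodalMinorUpc
import HarnessLib

/-!
# Connectivity correlation inequalities for `φ_{w,q}`, every `q > 0` — the DICTIONARY between census gen 25's weight-free antipodal sum
# `antipodalT` (behind the pair–apex row `δ ≥ 0`) and fk-2's antipodal functionals `apPsiC` / `apUpcC` (behind Theorem U);
# consequence: Conjecture T holds on every minor of a two-terminal series–parallel network between `s` and `t`, every `q > 0`

Theorems file (`--supports stmt-CriticalPhenomena-4575`), census lineage `prim-bschramm-census` (gen 26) of the post-continuity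
programme; builds on p205010 (kernel theorem, internal audit signed; external expert review pending).  One auxiliary definition
(`FK.apAttach`, the indicator `1{z ↔ s ∨ z ↔ t}` as a test function on finite edge sets), no named facts, no sorries; standard axioms.

THE DICTIONARY.  Census gen 25's polar form of the pair–apex row is, POINTWISE in the pair of configurations,
`Q(ω, ω') = (1{s↔t}(ω) − 1{s↔t}(ω')) · (1{z↔{s,t}}(ω) − 1{z↔{s,t}}(ω'))` (`antipodalQ_eq_mul`; a five-pattern case analysis), hence the
weight-free antipodal sum of the minor "contract `ρ`, keep `F`" is fk-2's antipodal covariance form of the two monotone test functions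
`1{s↔t}`, `1{z↔{s,t}}` with contracted set `ρ` (`antipodalT_eq_apPsiC`), which by the symmetry `γ ↦ F ∖ γ` is twice fk-2's
up-correlation functional against the ONE test function `γ ↦ 1{z ↔ {s,t} in γ ∪ ρ}` (`apPsiC_apConn_eq_two_mul_apUpcC`,
`antipodalT_eq_two_mul_apUpcC`).  So census gen 25's Conjecture T (`AntipodalTPos`: `antipodalT ≥ 0` on every minor of every graph, every
`q > 0`) is THEOREM U's conclusion for one particular monotone test function, asked on every graph; fk-2's `apUpcC_nonneg_of_isTTSP`
(Theorem U with a contracted set) gives it at once on every minor `(F, ρ)`, `F ∪ ρ ⊆ E`, of a two-terminal series–parallel network `E`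
between `s` and `t`, for every position of `z` and every `q > 0` (`antipodalT_nonneg_of_isTTSP`) — the weight-free companion of
`FK.pairApexUnder_of_isTTSP` (`…PairApexSP.lean`).
[cite: AyyerLinussonRavichandran2025, §7 eq. (13)–(15) (p. 22)] [cite: Grimmett2006, §1.4 eq. (1.20) (p. 15); §3.8 Thm. (3.90) (pp. 61–62); §3.9 (pp. 63–64)]
[cite: Wagner2006, Thm. 5.8(d), §5.3]
-/

noncomputable section

namespace Summit.CriticalPhenomena.PercolationContinuityZ3.Theorems

namespace FK

open Literature.Probability.LatticeModels Literature.Probability.Percolation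
open Literature.Probability.Percolation.DecisionTree (ind ind_of_mem ind_of_not_mem)
open scoped Classical

variable {V : Type*}

/-- **Attachment indicator** `apAttach A z s t = 1{z ↔ s ∨ z ↔ t in the open graph of A}` — the monotone test function of
Conjecture T in fk-2's finset language. [cite: AyyerLinussonRavichandran2025, §7 (p. 22)] -/
def apAttach (A : Finset (Sym2 V)) (z s t : V) : ℝ :=
  if (openGraph (↑A : BondConfig V)).Reachable z s ∨ (openGraph (↑A : BondConfig V)).Reachable z t then 1 else 0

/-- `apAttach` is monotone in the edge set. [folklore] -/
theorem apAttach_mono {A B : Finset (Sym2 V)} (h : A ⊆ B) (z s t : V) : apAttach A z s t ≤ apAttach B z s t := by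
  unfold apAttach
  have hle : openGraph (↑A : BondConfig V) ≤ openGraph (↑B : BondConfig V) := by
    intro x y hxy
    rw [openGraph, SimpleGraph.fromEdgeSet_adj] at hxy ⊢
    exact ⟨h hxy.1, hxy.2⟩
  by_cases hA : (openGraph (↑A : BondConfig V)).Reachable z s ∨ (openGraph (↑A : BondConfig V)).Reachable z t
  · have hB : (openGraph (↑B : BondConfig V)).Reachable z s ∨ (openGraph (↑B : BondConfig V)).Reachable z t :=
      hA.imp (fun h' => h'.mono hle) (fun h' => h'.mono hle)
    rw [if_pos hA, if_pos hB]
  · rw [if_neg hA]; split_ifs <;> norm_num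

/-- The five connection patterns of `{z,s,t}` exhaust a configuration (values of the five pattern indicators). [folklore] -/
theorem pat_cases (z s t : V) (ω : BondConfig V) :
    (ind (patSep z s t) ω = 1 ∧ ind (patST z s t) ω = 0 ∧ ind (patZS z s t) ω = 0 ∧ ind (patZT z s t) ω = 0 ∧ ind (patAll z s t) ω = 0) ∨
    (ind (patSep z s t) ω = 0 ∧ ind (patST z s t) ω = 1 ∧ ind (patZS z s t) ω = 0 ∧ ind (patZT z s t) ω = 0 ∧ ind (patAll z s t) ω = 0) ∨
    (ind (patSep z s t) ω = 0 ∧ ind (patST z s t) ω = 0 ∧ ind (patZS z s t) ω = 1 ∧ ind (patZT z s t) ω = 0 ∧ ind (patAll z s t) ω = 0) ∨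
    (ind (patSep z s t) ω = 0 ∧ ind (patST z s t) ω = 0 ∧ ind (patZS z s t) ω = 0 ∧ ind (patZT z s t) ω = 1 ∧ ind (patAll z s t) ω = 0) ∨
    (ind (patSep z s t) ω = 0 ∧ ind (patST z s t) ω = 0 ∧ ind (patZS z s t) ω = 0 ∧ ind (patZT z s t) ω = 0 ∧ ind (patAll z s t) ω = 1) := by
  have hts : ω ∈ openConn t s ↔ ω ∈ openConn s t := ⟨fun h => SimpleGraph.Reachable.symm h, fun h => SimpleGraph.Reachable.symm h⟩
  by_cases hzs : ω ∈ openConn z s <;> by_cases hzt : ω ∈ openConn z t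
  · have hst : ω ∈ openConn s t := SimpleGraph.Reachable.trans (SimpleGraph.Reachable.symm hzs) hzt
    refine Or.inr (Or.inr (Or.inr (Or.inr ?_)))
    simp [ind, patSep, patST, patZS, patZT, patAll, hzs, hzt, hst]
  · have hst : ω ∉ openConn s t := fun h => hzt (SimpleGraph.Reachable.trans hzs h)
    refine Or.inr (Or.inr (Or.inl ?_))
    simp [ind, patSep, patST, patZS, patZT, patAll, hzs, hzt, hst]
  · have hst : ω ∉ openConn s t := fun h => hzs (SimpleGraph.Reachable.trans hzt (SimpleGraph.Reachable.symm h))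
    refine Or.inr (Or.inr (Or.inr (Or.inl ?_)))
    simp [ind, patSep, patST, patZS, patZT, patAll, hzs, hzt, hst]
  · by_cases hst : ω ∈ openConn s t
    · refine Or.inr (Or.inl ?_)
      simp [ind, patSep, patST, patZS, patZT, patAll, hzs, hzt, hst]
    · refine Or.inl ?_
      simp [ind, patSep, patST, patZS, patZT, patAll, hzs, hzt, hst]

/-- **The polar form is a product of two antisymmetrised monotone indicators**:
`Q(ω, ω') = (1{s↔t}(ω) − 1{s↔t}(ω')) · (1{z↔{s,t}}(ω) − 1{z↔{s,t}}(ω'))`. [folklore] -/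
theorem antipodalQ_eq_mul (z s t : V) (ω ω' : BondConfig V) :
    antipodalQ z s t ω ω' =
      (ind (openConn s t) ω - ind (openConn s t) ω') *
        (ind (openConn z s ∪ openConn z t) ω - ind (openConn z s ∪ openConn z t) ω') := by
  obtain ⟨-, -, -, h4, h5, -, -⟩ := ind_patterns z s t ω
  obtain ⟨-, -, -, h4', h5', -, -⟩ := ind_patterns z s t ω'
  rw [h4, h5, h4', h5']
  unfold antipodalQ
  rcases pat_cases z s t ω with ⟨a0, a1, a2, a3, a4⟩ | ⟨a0, a1, a2, a3, a4⟩ | ⟨a0, a1, a2, a3, a4⟩ | ⟨a0, a1, a2, a3, a4⟩ |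
      ⟨a0, a1, a2, a3, a4⟩ <;>
    rcases pat_cases z s t ω' with ⟨b0, b1, b2, b3, b4⟩ | ⟨b0, b1, b2, b3, b4⟩ | ⟨b0, b1, b2, b3, b4⟩ | ⟨b0, b1, b2, b3, b4⟩ |
      ⟨b0, b1, b2, b3, b4⟩ <;>
    simp only [a0, a1, a2, a3, a4, b0, b1, b2, b3, b4] <;> norm_num

/-- `apConn` is the indicator of `{s ↔ t}` read on the coerced configuration. [folklore] -/
theorem apConn_eq_ind (A : Finset (Sym2 V)) (s t : V) : apConn A s t = ind (openConn s t) (↑A : BondConfig V) := by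
  unfold apConn ind
  rfl

/-- `apAttach` is the indicator of `{z ↔ s} ∪ {z ↔ t}` read on the coerced configuration. [folklore] -/
theorem apAttach_eq_ind (A : Finset (Sym2 V)) (z s t : V) :
    apAttach A z s t = ind (openConn z s ∪ openConn z t) (↑A : BondConfig V) := by
  have hmem : (↑A : BondConfig V) ∈ openConn z s ∪ openConn z t ↔
      (openGraph (↑A : BondConfig V)).Reachable z s ∨ (openGraph (↑A : BondConfig V)).Reachable z t := by
    rw [Set.mem_union, mem_openConn_iff', mem_openConn_iff']
  unfold apAttach ind
  by_cases h : (openGraph (↑A : BondConfig V)).Reachable z s ∨ (openGraph (↑A : BondConfig V)).Reachable z t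
  · rw [if_pos h, if_pos (hmem.2 h)]
  · rw [if_neg h, if_neg (fun h' => h (hmem.1 h'))]

/-- **The covariance form of `1{s↔t}` against any test function is twice the up-correlation functional** (symmetry `γ ↦ E ∖ γ`):
`apPsiC q E C 1{s↔t} g = 2 · apUpcC q E C s t (γ ↦ g(γ ∪ C))`. [cite: Grimmett2006, §1.4 eq. (1.20) (p. 15); §3.8 (pp. 61–62)] -/
theorem apPsiC_apConn_eq_two_mul_apUpcC (q : ℝ) (E C : Finset (Sym2 V)) (s t : V) (g : Finset (Sym2 V) → ℝ) :
    apPsiC q E C (fun A => apConn A s t) g = 2 * apUpcC q E C s t (fun γ => g (γ ∪ C)) := by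
  have hsplit : apPsiC q E C (fun A => apConn A s t) g =
      apUpcC q E C s t (fun γ => g (γ ∪ C)) -
        ∑ γ ∈ E.powerset, q ^ apExpC E C γ * ((apConn (γ ∪ C) s t - apConn (E \ γ ∪ C) s t) * g (E \ γ ∪ C)) := by
    unfold apPsiC apUpcC
    rw [← Finset.sum_sub_distrib]
    refine Finset.sum_congr rfl fun γ _ => ?_
    ring
  have hflip : ∑ γ ∈ E.powerset, q ^ apExpC E C γ * ((apConn (γ ∪ C) s t - apConn (E \ γ ∪ C) s t) * g (E \ γ ∪ C)) =
      - apUpcC q E C s t (fun γ => g (γ ∪ C)) := by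
    simpa using sum_apSignC_compl q E C s t (fun δ => g (δ ∪ C))
  rw [hsplit, hflip]
  ring

/-- **The dictionary**: census gen 25's weight-free antipodal sum of the minor `(F, ρ)` is fk-2's antipodal covariance form with the
contracted set `ρ` of the two monotone test functions `1{s↔t}` and `1{z↔{s,t}}`. [cite: AyyerLinussonRavichandran2025, §7 (p. 22)]
[cite: Grimmett2006, §1.4 eq. (1.20) (p. 15)] -/
theorem antipodalT_eq_apPsiC [Fintype V] (q : ℝ) (z s t : V) (F C : Finset (Sym2 V)) :
    antipodalT q z s t (↑F : BondConfig V) (↑C : BondConfig V) =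
      apPsiC q F C (fun A => apConn A s t) (fun A => apAttach A z s t) := by
  unfold antipodalT apPsiC
  set G : BondConfig V → ℝ := fun X => if X ⊆ (↑F : BondConfig V) then
      q ^ (clusterCount ((↑C : BondConfig V) ∪ X) ∅ + clusterCount ((↑C : BondConfig V) ∪ ((↑F : BondConfig V) \ X)) ∅) *
        antipodalQ z s t ((↑C : BondConfig V) ∪ X) ((↑C : BondConfig V) ∪ ((↑F : BondConfig V) \ X)) else 0 with hG
  have h1 : (∑ X : BondConfig V, G X) = ∑ S : Finset (Sym2 V), G (↑S : BondConfig V) := by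
    rw [← Equiv.sum_comp Fintype.finsetEquivSet G]
    rfl
  have h2 : (∑ S : Finset (Sym2 V), G (↑S : BondConfig V)) =
      ∑ S : Finset (Sym2 V), if S ∈ F.powerset then G (↑S : BondConfig V) else 0 := by
    refine Finset.sum_congr rfl fun S _ => ?_
    by_cases hS : S ∈ F.powerset
    · rw [if_pos hS]
    · rw [if_neg hS, hG]
      simp only
      rw [if_neg]
      rwa [Finset.coe_subset, ← Finset.mem_powerset]
  have h3 : (∑ S : Finset (Sym2 V), if S ∈ F.powerset then G (↑S : BondConfig V) else 0) =
      ∑ S ∈ F.powerset, G (↑S : BondConfig V) := by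
    rw [← Finset.sum_filter]
    congr 1
    ext S
    simp
  rw [h1, h2, h3]
  refine Finset.sum_congr rfl fun S hS => ?_
  have hSF : S ⊆ F := Finset.mem_powerset.1 hS
  have hsub : (↑S : BondConfig V) ⊆ ↑F := Finset.coe_subset.2 hSF
  have e1 : (↑C : BondConfig V) ∪ ↑S = ↑(S ∪ C) := by rw [Finset.coe_union, Set.union_comm]
  have e2 : (↑C : BondConfig V) ∪ ((↑F : BondConfig V) \ ↑S) = ↑(F \ S ∪ C) := by
    rw [Finset.coe_union, Finset.coe_sdiff, Set.union_comm]
  rw [hG]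
  simp only
  rw [if_pos hsub, e1, e2, antipodalQ_eq_mul, apConn_eq_ind, apConn_eq_ind, apAttach_eq_ind, apAttach_eq_ind]
  rfl

/-- **Conjecture T's sum is twice Theorem U's functional** against the one test function `γ ↦ 1{z ↔ {s,t} in γ ∪ ρ}`:
`antipodalT q z s t F ρ = 2 · apUpcC q F ρ s t (γ ↦ apAttach (γ ∪ ρ) z s t)`. [cite: AyyerLinussonRavichandran2025, §7 (p. 22)]
[cite: Grimmett2006, §3.8 Thm. (3.90) (pp. 61–62)] -/
theorem antipodalT_eq_two_mul_apUpcC [Fintype V] (q : ℝ) (z s t : V) (F C : Finset (Sym2 V)) :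
    antipodalT q z s t (↑F : BondConfig V) (↑C : BondConfig V) = 2 * apUpcC q F C s t (fun γ => apAttach (γ ∪ C) z s t) := by
  rw [antipodalT_eq_apPsiC, apPsiC_apConn_eq_two_mul_apUpcC]

/-- **Conjecture T on two-terminal series–parallel networks, every `q > 0`**: if `E` is a two-terminal series–parallel network
between `s` and `t`, then for every minor `(F, ρ)` with `F, ρ ⊆ E`, every vertex `z` and every `q > 0`,
`antipodalT q z s t F ρ ≥ 0` — by the dictionary and fk-2's Theorem U with a contracted set (`apUpcC_nonneg_of_isTTSP`).
(Census gen 25 verified the statement for ALL graphs with `≤ 9` vertices; here it is a theorem on the SP class for every size.)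
[cite: AyyerLinussonRavichandran2025, §7 eq. (13)–(15) (p. 22)] [cite: Grimmett2006, §3.8 Thm. (3.90) (pp. 61–62); §3.9 (pp. 63–64)]
[cite: Wagner2006, Thm. 5.8(d), §5.3] -/
theorem antipodalT_nonneg_of_isTTSP [Fintype V] {q : ℝ} (hq : 0 < q) {E : Finset (Sym2 V)} {s t : V} (hE : IsTTSP E s t)
    {F C : Finset (Sym2 V)} (hF : F ⊆ E) (hC : C ⊆ E) (z : V) :
    0 ≤ antipodalT q z s t (↑F : BondConfig V) (↑C : BondConfig V) := by
  rw [antipodalT_eq_two_mul_apUpcC]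
  refine mul_nonneg (by norm_num) ?_
  refine apUpcC_nonneg_of_isTTSP hq hE F C hF hC (fun γ => apAttach (γ ∪ C) z s t) ?_
  intro A B hAB _
  exact apAttach_mono (Finset.union_subset_union hAB le_rfl) z s t

end FK

end Summit.CriticalPhenomena.PercolationContinuityZ3.Theorems

end
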